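import Summits.NavierStokesRegularity.NavierStokesRegularity.Theorems.SoloSalvageChaabani2020Step4Lemmas
import Literature.Analysis.FluidPDE.TorusClassicalH1Balance
import Literature.Analysis.FluidPDE.TorusClassicalLerayHopfProofs
import Literature.Analysis.FluidPDE.CheskidovAssemblyTools
import Literature.Analysis.FunctionSpaces.TorusCalculusProofs
import Literature.Analysis.ODE.OneSidedComparison
import HarnessLib

/-!
# Solo salvage for claim C22 `Chaabani2020`, part 5: Step 4 (case (2.3)) HOLDS

Continuation of `Theorems/SoloSalvageChaabani2020Step4Lemmas.lean` (seat `ns-claims-salvage-p2`). Step 4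
of `Literature/Claims/NS/Chaabani2020.lean` (l.216–228 p.5–6): on an interval where
`F_m(u) = Σ_{|k|≤m}|û| − Σ_{|k|>m}|û| ≥ 0`, a classical mean-zero solution on `𝕋³` obeys
`‖∇u(t)‖² ≤ ‖∇u(t₀)‖² exp{2C(m)‖u₀‖²(t−t₀)}`, `C(m) = 2#{|k|≤m}/ν`. Proof as the paper says, assembled
from tree theorems: the `H¹` balance `d/dt ½‖∇u‖² = −ν‖Δu‖² + ∫⟪(u·∇)u, Δu⟫`
(`Torus.IsClassicalNSSolutionOn.hasDerivWithinAt_half_gradNormSq`); the pointwise bound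
`‖(u·∇)u‖ ≤ ‖u‖ |∇u|` and the Wiener control `‖u‖_∞ ≤ 2√(countLow m)‖u‖₂` of part 4
(`norm_le_of_splitF_nonneg`); the energy decay `‖u(t)‖₂ ≤ ‖u(0)‖₂` (`energy_eq`); Young; Grönwall
(`Literature.Analysis.ODE.le_mul_exp_of_deriv_right_le`). We get the rate `C(m)‖u₀‖²`, i.e. the printed
bound with room to spare.

* `step4_holds : Step_4`.

WHAT THIS IS NOT: not a claim about NS regularity or blow-up; not a claim about any author beyond the
typed locator.
-/

noncomputable section

open Set MeasureTheory Filter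
open scoped RealInnerProductSpace

-- The mandated landing namespace repeats the summit name by design (D-0017).
set_option linter.dupNamespace false

namespace Summit.NavierStokesRegularity.NavierStokesRegularity.Theorems

namespace Chaabani2020

open Literature.Claims.NS.Chaabani2020 Literature.Analysis Literature.Analysis.FluidPDE
  Literature.Analysis.FunctionSpaces

/-- Pointwise bound of the self-convection term: `‖(v·∇)v(x)‖ ≤ ‖v(x)‖ · (Σᵢ‖∂ᵢv(x)‖²)^{1/2}`
(`(v·∇)v = Σᵢ vᵢ ∂ᵢv` and Cauchy–Schwarz in `ℝ³`). [folklore] -/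
private theorem norm_convect_self_le {v : UnitAddTorus (Fin 3) → EuclideanSpace ℝ (Fin 3)}
    (hv : Torus.IsContDiff 1 v) (x : UnitAddTorus (Fin 3)) :
    ‖Torus.convect v v x‖ ≤ ‖v x‖ * Real.sqrt (∑ i, ‖Torus.partialDeriv i v x‖ ^ 2) := by
  rw [Torus.convect, Torus.fderiv_apply_eq_sum_partialDeriv hv]
  calc ‖∑ i, v x i • Torus.partialDeriv i v x‖
        ≤ ∑ i, ‖v x i‖ * ‖Torus.partialDeriv i v x‖ :=
          (norm_sum_le _ _).trans (Finset.sum_le_sum fun i _ => by rw [norm_smul])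
    _ ≤ Real.sqrt (∑ i, ‖v x i‖ ^ 2) * Real.sqrt (∑ i, ‖Torus.partialDeriv i v x‖ ^ 2) :=
          Real.sum_mul_le_sqrt_mul_sqrt _ _ _
    _ = ‖v x‖ * Real.sqrt (∑ i, ‖Torus.partialDeriv i v x‖ ^ 2) := by
          rw [EuclideanSpace.norm_eq]

/-- `∫‖(v·∇)v‖² ≤ M² ‖∇v‖₂²` when `‖v‖ ≤ M` pointwise (smooth `v`). [folklore] -/
private theorem integral_norm_convect_sq_le {v : UnitAddTorus (Fin 3) → EuclideanSpace ℝ (Fin 3)}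
    (hv : Torus.IsSmooth v) {M : ℝ} (hM : ∀ x, ‖v x‖ ≤ M) :
    ∫ x, ‖Torus.convect v v x‖ ^ 2 ∂volume ≤ M ^ 2 * Torus.gradNormSq v := by
  have hM0 : 0 ≤ M := (norm_nonneg _).trans (hM 0)
  have h1 : Torus.IsContDiff 1 v := hv.isContDiff (by simp)
  have hpt : ∀ x, ‖Torus.convect v v x‖ ^ 2 ≤ M ^ 2 * ∑ i, ‖Torus.partialDeriv i v x‖ ^ 2 := by
    intro x
    have hS0 : 0 ≤ ∑ i, ‖Torus.partialDeriv i v x‖ ^ 2 := Finset.sum_nonneg fun i _ => sq_nonneg _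
    calc ‖Torus.convect v v x‖ ^ 2
          ≤ (‖v x‖ * Real.sqrt (∑ i, ‖Torus.partialDeriv i v x‖ ^ 2)) ^ 2 :=
            pow_le_pow_left₀ (norm_nonneg _) (norm_convect_self_le h1 x) 2
      _ = ‖v x‖ ^ 2 * ∑ i, ‖Torus.partialDeriv i v x‖ ^ 2 := by
            rw [mul_pow, Real.sq_sqrt hS0]
      _ ≤ M ^ 2 * ∑ i, ‖Torus.partialDeriv i v x‖ ^ 2 :=
            mul_le_mul_of_nonneg_right (pow_le_pow_left₀ (norm_nonneg _) (hM x) 2) hS0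
  have hint : Integrable (fun x => ∑ i, ‖Torus.partialDeriv i v x‖ ^ 2) volume :=
    (continuous_finsetSum _ fun i _ => ((hv.partialDeriv i).continuous.norm.pow 2)).integrable_of_hasCompactSupport
      (HasCompactSupport.of_compactSpace _)
  unfold Torus.gradNormSq
  rw [← integral_const_mul]
  exact integral_mono_of_nonneg (ae_of_all _ fun x => sq_nonneg _) (hint.const_mul _)
    (ae_of_all _ hpt)

/-- **Step 4 HOLDS** (case (2.3), l.216–228 p.5–6): `F_m ≥ 0` on `[t₀,t₁)` ⇒
`‖∇u(t)‖² ≤ ‖∇u(t₀)‖² exp{2C(m)‖u₀‖²(t−t₀)}` there (H¹ balance, `‖(u·∇)u‖₂ ≤ ‖u‖_∞‖∇u‖₂`, Wiener control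
`‖u‖_∞ ≤ 2√(countLow m)‖u‖₂ ≤ 2√(countLow m)‖u₀‖₂`, Young, Grönwall).
[cite: Chaabani2020, §2 l.216–228 p.5–6] -/
theorem step4_holds : Literature.Claims.NS.Chaabani2020.Step_4 := by
  intro ν hν T hT u p h hmean m t₀ t₁ ht₀ ht₀₁ ht₁T hF t ht
  rcases eq_or_lt_of_le ht.1 with h0 | ht₀t
  · subst h0
    simp
  -- the window `[t₀, t]`
  have hsub : Icc t₀ t ⊆ Ico 0 T := fun s hs => ⟨ht₀.trans hs.1, lt_of_le_of_lt hs.2 (ht.2.trans_le ht₁T)⟩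
  have hU : UniqueDiffOn ℝ (Icc t₀ t) := uniqueDiffOn_Icc ht₀t
  have hI : Torus.IsClassicalNSSolutionOn (Icc t₀ t) ν 0 u p := h.mono hsub hU
  have hu : Torus.IsSmoothSpaceTimeOn (Ico 0 T) u := h.smooth_velocity
  -- constants
  set N : ℝ := countLow m with hN
  have hN0 : 0 ≤ N := by rw [hN, countLow_eq_card]; exact Nat.cast_nonneg _
  set E0 : ℝ := ∫ x, ‖u 0 x‖ ^ 2 ∂volume with hE0
  have hE00 : 0 ≤ E0 := integral_nonneg fun x => sq_nonneg _
  set β : ℝ := 2 * caseConst ν m * E0 with hβ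
  -- energy decay: `∫‖u s‖² ≤ ∫‖u 0‖²` for `0 ≤ s < T`
  have hdecay : ∀ s ∈ Ico 0 T, ∫ x, ‖u s x‖ ^ 2 ∂volume ≤ E0 := by
    intro s hs
    have hE := h.energy_eq (convex_Ico 0 T) hs.1 (fun σ hσ => ⟨hσ.1, hσ.2.trans_lt hs.2⟩)
    simp only [Pi.zero_apply, inner_zero_left, integral_zero, intervalIntegral.integral_zero,
      add_zero] at hE
    have hGi : 0 ≤ ∫ τ in (0 : ℝ)..s, Torus.gradNormSq (u τ) :=
      intervalIntegral.integral_nonneg hs.1 fun τ _ => Torus.gradNormSq_nonneg _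
    have hK : Torus.kineticEnergy (u s) ≤ Torus.kineticEnergy (u 0) := by nlinarith
    unfold Torus.kineticEnergy at hK
    linarith
  -- sup bound on `[t₀, t]`: `‖u s x‖ ≤ M := 2 √N √E0`
  set M : ℝ := 2 * (Real.sqrt N * Real.sqrt E0) with hM
  have hM0 : 0 ≤ M := by positivity
  have hsup : ∀ s ∈ Icc t₀ t, ∀ x, ‖u s x‖ ≤ M := by
    intro s hs x
    have hsT : s ∈ Ico 0 T := hsub hs
    have hFs : 0 ≤ splitF m (u s) := hF s ⟨hs.1, hs.2.trans_lt ht.2⟩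
    refine (norm_le_of_splitF_nonneg (hu.isSmooth_slice hsT) hFs x).trans ?_
    rw [hM, ← hN]
    gcongr
    exact hdecay s hsT
  -- the `H¹` balance and its bound
  set L : ℝ → ℝ := fun s => ∫ x, ‖Torus.laplacian (u s) x‖ ^ 2 ∂volume with hL
  set P : ℝ → ℝ := fun s => ∫ x, ⟪Torus.convect (u s) (u s) x -
      (0 : ℝ → UnitAddTorus (Fin 3) → EuclideanSpace ℝ (Fin 3)) s x, Torus.laplacian (u s) x⟫ ∂volume with hP
  set G : ℝ → ℝ := fun s => Torus.gradNormSq (u s) with hG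
  set G' : ℝ → ℝ := fun s => 2 * (-ν * L s + P s) with hG'
  have hderiv : ∀ s ∈ Icc t₀ t, HasDerivWithinAt G (G' s) (Icc t₀ t) s := by
    intro s hs
    have h2 := (hI.hasDerivWithinAt_half_gradNormSq ht₀t hs).const_mul (2 : ℝ)
    have hfun : (fun y => (2 : ℝ) * (2⁻¹ * Torus.gradNormSq (u y))) = G := by
      funext y; simp only [hG]; ring
    rw [hfun] at h2
    exact h2
  have hbound : ∀ s ∈ Ico t₀ t, G' s ≤ β * G s := by
    intro s hs
    have hs' : s ∈ Icc t₀ t := Ico_subset_Icc_self hs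
    have hsT : s ∈ Ico 0 T := hsub hs'
    have hus : Torus.IsSmooth (u s) := hu.isSmooth_slice hsT
    have hLs0 : 0 ≤ L s := integral_nonneg fun x => sq_nonneg _
    have hGs0 : 0 ≤ G s := Torus.gradNormSq_nonneg _
    -- `P s ≤ √(M² G) √L`
    have hconv : ∫ x, ‖Torus.convect (u s) (u s) x‖ ^ 2 ∂volume ≤ M ^ 2 * G s :=
      integral_norm_convect_sq_le hus (hsup s hs')
    have hmem1 : MemLp (Torus.convect (u s) (u s)) 2 volume :=
      ((hu.convect hu (uniqueDiffOn_Ico 0 T)).isSmooth_slice hsT).memLp 2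
    have hmem2 : MemLp (Torus.laplacian (u s)) 2 volume :=
      ((hu.laplacian (uniqueDiffOn_Ico 0 T)).isSmooth_slice hsT).memLp 2
    have hPle : P s ≤ Real.sqrt (M ^ 2 * G s) * Real.sqrt (L s) := by
      have hP' : P s = ∫ x, ⟪Torus.convect (u s) (u s) x, Torus.laplacian (u s) x⟫ ∂volume := by
        simp only [hP, Pi.zero_apply, sub_zero]
      rw [hP']
      refine (le_abs_self _).trans ((abs_integral_inner_le_sqrt_mul_sqrt hmem1 hmem2).trans ?_)
      exact mul_le_mul_of_nonneg_right (Real.sqrt_le_sqrt hconv) (Real.sqrt_nonneg _)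
    -- Young: `√(M²G) √L ≤ ν L + M² G /(4ν)`
    have hyoung : Real.sqrt (M ^ 2 * G s) * Real.sqrt (L s) ≤ ν * L s + M ^ 2 * G s / (4 * ν) := by
      set a : ℝ := Real.sqrt (M ^ 2 * G s) with ha_def
      set b : ℝ := Real.sqrt (L s) with hb_def
      have ha : a ^ 2 = M ^ 2 * G s := Real.sq_sqrt (by positivity)
      have hb : b ^ 2 = L s := Real.sq_sqrt hLs0
      have key : a * b ≤ ν * b ^ 2 + a ^ 2 / (4 * ν) := by
        rw [← sub_nonneg]
        have hrw : ν * b ^ 2 + a ^ 2 / (4 * ν) - a * b = (2 * ν * b - a) ^ 2 / (4 * ν) := by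
          field_simp
          ring
        rw [hrw]
        positivity
      rw [hb, ha] at key
      exact key
    -- assemble: `G' ≤ M² G/(2ν) = (2N E0/ν) G ≤ β G`
    have hM2 : M ^ 2 = 4 * N * E0 := by
      rw [hM]
      have h1 := Real.sq_sqrt hN0
      have h2 := Real.sq_sqrt hE00
      nlinarith
    have hrate : M ^ 2 / (2 * ν) ≤ β := by
      rw [hM2, hβ, caseConst]
      rw [div_le_iff₀ (by positivity)]
      have : 2 * (2 * countLow m / ν) * E0 * (2 * ν) = 8 * countLow m * E0 := by
        field_simp
        ring
      rw [this, ← hN]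
      nlinarith
    calc G' s = 2 * (-ν * L s + P s) := rfl
      _ ≤ 2 * (-ν * L s + (ν * L s + M ^ 2 * G s / (4 * ν))) := by nlinarith
      _ = M ^ 2 / (2 * ν) * G s := by field_simp; ring
      _ ≤ β * G s := mul_le_mul_of_nonneg_right hrate hGs0
  -- Grönwall on `[t₀, t]`
  have hcont : ContinuousOn G (Icc t₀ t) := fun s hs => (hderiv s hs).continuousWithinAt
  have hderiv' : ∀ s ∈ Ico t₀ t, HasDerivWithinAt G (G' s) (Ici s) s := fun s hs =>
    (hderiv s (Ico_subset_Icc_self hs)).mono_of_mem_nhdsWithin (Icc_mem_nhdsGE_of_mem hs)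
  have hgron := Literature.Analysis.ODE.le_mul_exp_of_deriv_right_le hcont hderiv' hbound t
    ⟨ht₀t.le, le_rfl⟩
  have hexp : β * (t - t₀) = 2 * caseConst ν m * (∫ x, ‖u 0 x‖ ^ 2 ∂volume) * (t - t₀) := by
    rw [hβ]
  rw [hexp] at hgron
  exact hgron

end Chaabani2020

end Summit.NavierStokesRegularity.NavierStokesRegularity.Theorems
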